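import Summits.CriticalPhenomena.Ising3DConformalLimit.Theses.CoerciveSharpness
import Summits.CriticalPhenomena.Ising3DConformalLimit.Theorems.LatticeSDPCertificatesWindowBelowHalf
import Literature.Probability.LatticeModels.CriticalTwoPointDCPLowerProofs
import Literature.Probability.LatticeModels.CriticalEtaUpperDCPProofs
import HarnessLib

/-!
# Line `eta_deficit` for the crux `CoerciveSharpness.WindowOfGrowth`
(item stmt-CriticalPhenomena-18198, route `route-CriticalPhenomena-CoerciveSharpness`, rank 4) —
crux-strategist skeleton (planner-cstrat-stmt-CriticalPhenomena-18198-b1-0, 2026-08-17)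

The crux (verbatim, `Theses/CoerciveSharpness.lean`):
`GrowingReflectedGradient → (∃ η, HasIsingEtaBounds 3 η) → WINDOW`, where
* `GrowingReflectedGradient` = `∃ κ' c₀ > 0, ∃ N₀, ∀ n ≥ N₀, c₀ n^{κ'} ≤ Q(n)`, `Q(n)` the route's
  WRITTEN-OUT reflected gradient of Duminil-Copin–Panis (arXiv:2404.05700, Thm 1.2) at `β_c(3)`,
  `Q(n) = Σ_{x ∈ Λ_n} Σ_{i<3} Σ_{±} 1_{x±e_i ∈ Λ_n} (⟨σ₀σ_x⟩^f - ⟨σ₀σ_{R_n x}⟩^f) ⟨σ_{x±e_i} σ_{R_n(x±e_i)}⟩^f`,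
  `R_n x = Function.update x 0 (2n - x 0)` (`= dcpReflect 0 n x` by `rfl`);
* `HasIsingEtaBounds 3 η` = `c‖x‖^{-(1+η)} ≤ ⟨σ₀σ_x⟩⁺_{β_c} ≤ C‖x‖^{-(1+η)}` (`x ≠ 0`);
* WINDOW = `∃ ε c > 0, ∀ 1 ≤ m ≤ n, c (n/m)^{-(3/2-ε)} G(m e₁) ≤ G(n e₁)`
  (= `LatticeSDPCertificates.WindowBelowHalf`, item 5507, syntactically).

## The line: "growth of Q costs 2η + κ' ≤ 1" (DC–Panis Thm 1.3/1.5 run pointwise in `n`)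

1. `stub_reflGrad_le_majorant` (HARDEST, size M): for every `n ≥ 1`,
   `Q(4n) ≤ 6 · Σ_{x ∈ Λ_{4n}} majorant_n(x)`, where `majorant_n` is EXACTLY the termwise majorant
   of the tree's proof of DC–Panis Thm 1.3 (`DCP.term_le_of_le` for `x₀ ≤ 2n`, `DCP.term_le_of_lt`
   for `x₀ > 2n`, `CriticalTwoPointDCPLowerProofs.lean` Part 2), written with
   `criticalTwoPoint 3 = twoPointPlus 3 (criticalBeta 3)` (rfl). Proof plan: rewrite the free-state
   quantities of `Q` into the plus state (`DCP.twoPointFree_criticalBeta_eq`,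
   `DCP.freeExpect_spinPair_dcpReflect` after `Function.update … = dcpReflect 0 (4n) …`, rfl), then for
   each `x ∈ Λ_{4n}` each of the ≤ 6 terms `(i, ±)` is ≤ `majorant_n(x)` (the neighbour `y = x ± e_i`
   is adjacent: `zdGraph_adj_iff`), absent terms are `0 ≤ majorant_n(x)` (`DCP.majorant_nonneg`);
   sum. This is `DCP.row_sum_le` re-run on the `Σ_i (± e_i)` form (no neighbour count needed).
2. `stub_denominator_le` (size S–M): the denominator estimate of the tree's proof of Thm 1.5,
   `Σ_{Λ_{4n}} F + n Σ_{k ≤ 2n} k F(k e₁) ≤ (1 + 872 K) n^{2-b}` under `F ≤ K‖x‖^{-(1+b)}`, for the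
   FULL range `0 ≤ b ≤ 3/4` (the tree's `dcp_denominator_le`, `CriticalEtaUpperDCPProofs.lean`, is
   stated for `1/2 < b ≤ 3/4` but its proof uses only `0 ≤ b ≤ 3/4`: copy it).
3. Composition `WindowOfGrowth_of` (PROVED below, no sorry): with `b := min η 3/4` the two stubs and
   the tree's `DCP.sum_majorant_le` give `Q(4n) ≤ 5838·C·(1+872C)·n^{1-2b}` for all `n ≥ 1`; the
   growth hypothesis at scale `4n` gives `c₀ n^{κ'} ≤ c₀ (4n)^{κ'} ≤ Q(4n)`; hence
   `n^{κ'-(1-2b)}` is bounded, so `κ' + 2b ≤ 1` (`exponent_nonpos_of_bounded`), `b < 1/2`, `b = η`,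
   **`η ≤ (1-κ')/2 < 1/2`** (the η-DEFICIT), and WINDOW follows from the tree's
   `windowBelowHalf_of_hasIsingEtaBounds` (`Theorems/LatticeSDPCertificatesWindowBelowHalf.lean`).
   `η ≥ 0` (needed for `0 ≤ b`) is derived inside from the infrared bound
   (`criticalTwoPoint_bounds_holds`).

`lean check`: rc 0, sorries ONLY in the two `stub_*`; `WindowOfGrowth_of` concludes the crux BY NAME.
-/

noncomputable section

namespace Summit.CriticalPhenomena.Ising3DConformalLimit.Cruxes.WindowOfGrowth.EtaDeficit

open scoped BigOperators
open Filter Finset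
open Literature.Probability.LatticeModels
open Summit.CriticalPhenomena.Ising3DConformalLimit.Theses.CoerciveSharpness (WindowOfGrowth)

/-! ### The two registered stubs -/

/-- **stub 1 (hardest) — DC–Panis majorant domination at every scale.** For every `n ≥ 1` the
route's written-out reflected gradient at scale `4n` is at most `6 Σ_{x ∈ Λ_{4n}} majorant_n(x)`,
`majorant_n(x) = ⟨σ₀σ_x⟩⟨σ₀σ_{ne₁}⟩` if `x₀ ≤ 2n`, else
`(4(4n - x₀)/n) ⟨σ₀σ_{ne₁}⟩ ⟨σ₀σ_{(4n-x₀-1)e₁}⟩` (plus state `criticalTwoPoint 3`; the majorant of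
`DCP.term_le_of_le` / `DCP.term_le_of_lt`, summable by `DCP.sum_majorant_le`). Size M.
Leans on: `DCP.twoPointFree_criticalBeta_eq`, `DCP.freeExpect_spinPair_dcpReflect` (`dcpReflect 0 N x`
is `Function.update x 0 (2N - x 0)` by rfl), `DCP.term_le_of_le`, `DCP.term_le_of_lt`,
`DCP.majorant_nonneg`, `zdGraph_adj_iff`. -/
theorem stub_reflGrad_le_majorant :
    ∀ n : ℕ, 1 ≤ n →
      (∑ x ∈ box 3 (4 * n), ∑ i : Fin 3,
        ((if x + Pi.single i 1 ∈ box 3 (4 * n) then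
            (twoPointFree 3 (criticalBeta 3) x -
                twoPointFree 3 (criticalBeta 3) (Function.update x (0 : Fin 3) (2 * ((4 * n : ℕ) : ℤ) - x 0))) *
              freeExpect 3 (criticalBeta 3) 0
                (spinPair (x + Pi.single i 1)
                  (Function.update (x + Pi.single i 1) (0 : Fin 3)
                    (2 * ((4 * n : ℕ) : ℤ) - (x + Pi.single i 1 : Site 3) 0)))
          else 0) +
         (if x - Pi.single i 1 ∈ box 3 (4 * n) then
            (twoPointFree 3 (criticalBeta 3) x -
                twoPointFree 3 (criticalBeta 3) (Function.update x (0 : Fin 3) (2 * ((4 * n : ℕ) : ℤ) - x 0))) *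
              freeExpect 3 (criticalBeta 3) 0
                (spinPair (x - Pi.single i 1)
                  (Function.update (x - Pi.single i 1) (0 : Fin 3)
                    (2 * ((4 * n : ℕ) : ℤ) - (x - Pi.single i 1 : Site 3) 0)))
          else 0))) ≤
      6 * ∑ x ∈ box 3 (4 * n),
        (if x 0 ≤ 2 * (n : ℤ) then
            criticalTwoPoint 3 x * criticalTwoPoint 3 (Pi.single 0 (n : ℤ))
         else 4 * ((((4 * n : ℕ) : ℤ) - x 0 : ℤ) : ℝ) / n * criticalTwoPoint 3 (Pi.single 0 (n : ℤ)) *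
           criticalTwoPoint 3 (Pi.single 0 (((4 * n : ℕ) : ℤ) - x 0 - 1))) := by
  sorry

/-- **stub 2 — the denominator of DC–Panis (1.9) under a power upper bound, full range
`0 ≤ b ≤ 3/4`.** If `F : ℤ³ → ℝ` has `F 0 = 1` and `F x ≤ K‖x‖^{-(1+b)}` (`x ≠ 0`), then for `n ≥ 1`
`Σ_{x ∈ Λ_{4n}} F x + n Σ_{k=1}^{2n} k F(k e₁) ≤ (1 + 872K) n^{2-b}`. The tree's `dcp_denominator_le`
(`CriticalEtaUpperDCPProofs.lean`) is this with the hypothesis `1/2 < b`; its proof only uses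
`0 ≤ b ≤ 3/4` (shell estimate `sum_box_erase_norm_rpow_le`, `sum_Icc_rpow_sub_one_le` with
`p = 1 - b ∈ [1/4, 1]`, `4^{1-b} ≤ 4`). Size S–M (copy-adapt). -/
theorem stub_denominator_le :
    ∀ (F : Site 3 → ℝ) (K b : ℝ), 0 < K → 0 ≤ b → b ≤ 3 / 4 → F 0 = 1 →
      (∀ x : Site 3, x ≠ 0 → F x ≤ K * ‖x‖ ^ (-(1 + b))) →
      ∀ n : ℕ, 1 ≤ n →
        (∑ x ∈ box 3 (4 * n), F x) +
            (n : ℝ) * ∑ k ∈ Finset.Icc 1 (2 * n), (k : ℝ) * F (Pi.single 0 (k : ℤ)) ≤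
          (1 + 872 * K) * (n : ℝ) ^ (2 - b) := by
  sorry

/-! ### Proved glue -/

/-- If `c n^a ≤ C` for all large `n` with `c > 0`, then `a ≤ 0`. [folklore] -/
theorem exponent_nonpos_of_bounded {a c C : ℝ} {N : ℕ} (hc : 0 < c)
    (h : ∀ n : ℕ, N ≤ n → c * (n : ℝ) ^ a ≤ C) : a ≤ 0 := by
  by_contra ha
  have ha' : 0 < a := lt_of_not_ge ha
  have hlim : Tendsto (fun n : ℕ => c * (n : ℝ) ^ a) atTop atTop :=
    Tendsto.const_mul_atTop hc ((tendsto_rpow_atTop ha').comp tendsto_natCast_atTop_atTop)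
  obtain ⟨n, hn1, hn2⟩ := ((hlim.eventually_gt_atTop C).and (eventually_ge_atTop N)).exists
  exact absurd (h n hn2) (not_le.2 hn1)

/-- The real-variable bookkeeping of the composition: with `G_n ≤ C A`, `χ ≤ D U`,
`1 + 2K ≤ 3DU/t`, `P ≤ 81 t²` (all quantities nonnegative, `t > 0`),
`G_n χ + (4 G_n / t) P (1 + 2K) ≤ 973 · C D · A U`. [folklore] -/
theorem majorant_algebra {Gn χ K P t A U C D : ℝ} (ht : 0 < t) (hA : 0 ≤ A) (hU : 0 ≤ U)
    (hC : 0 ≤ C) (hD : 0 ≤ D) (hGn0 : 0 ≤ Gn) (hGn : Gn ≤ C * A) (hχ0 : 0 ≤ χ) (hχ : χ ≤ D * U)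
    (hK0 : 0 ≤ K) (hK : 1 + 2 * K ≤ 3 * D * U / t) (hP0 : 0 ≤ P) (hP : P ≤ 81 * t ^ 2) :
    Gn * χ + 4 * Gn / t * P * (1 + 2 * K) ≤ 973 * (C * D * (A * U)) := by
  have h1 : Gn * χ ≤ (C * A) * (D * U) := mul_le_mul hGn hχ hχ0 (by positivity)
  have ha : 4 * Gn / t ≤ 4 * (C * A) / t :=
    div_le_div_of_nonneg_right (by linarith) ht.le
  have hb : 0 ≤ 4 * Gn / t := by positivity
  have hK1 : 0 ≤ 1 + 2 * K := by positivity
  have h2 : 4 * Gn / t * P * (1 + 2 * K) ≤ 4 * (C * A) / t * (81 * t ^ 2) * (3 * D * U / t) :=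
    mul_le_mul (mul_le_mul ha hP hP0 (by positivity)) hK hK1 (by positivity)
  have h3 : 4 * (C * A) / t * (81 * t ^ 2) * (3 * D * U / t) = 972 * (C * D * (A * U)) := by
    field_simp
    ring
  have h4 : 0 ≤ C * D * (A * U) := by positivity
  linarith [h1, h2, h3, h4]

/-! ### The composition: the two stubs imply the crux BY NAME -/

/-- **`WindowOfGrowth` from the two stubs** (kernel-checked composition of the line). -/
theorem WindowOfGrowth_of
    (h1 : ∀ n : ℕ, 1 ≤ n →
      (∑ x ∈ box 3 (4 * n), ∑ i : Fin 3,
        ((if x + Pi.single i 1 ∈ box 3 (4 * n) then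
            (twoPointFree 3 (criticalBeta 3) x -
                twoPointFree 3 (criticalBeta 3) (Function.update x (0 : Fin 3) (2 * ((4 * n : ℕ) : ℤ) - x 0))) *
              freeExpect 3 (criticalBeta 3) 0
                (spinPair (x + Pi.single i 1)
                  (Function.update (x + Pi.single i 1) (0 : Fin 3)
                    (2 * ((4 * n : ℕ) : ℤ) - (x + Pi.single i 1 : Site 3) 0)))
          else 0) +
         (if x - Pi.single i 1 ∈ box 3 (4 * n) then
            (twoPointFree 3 (criticalBeta 3) x -
                twoPointFree 3 (criticalBeta 3) (Function.update x (0 : Fin 3) (2 * ((4 * n : ℕ) : ℤ) - x 0))) *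
              freeExpect 3 (criticalBeta 3) 0
                (spinPair (x - Pi.single i 1)
                  (Function.update (x - Pi.single i 1) (0 : Fin 3)
                    (2 * ((4 * n : ℕ) : ℤ) - (x - Pi.single i 1 : Site 3) 0)))
          else 0))) ≤
      6 * ∑ x ∈ box 3 (4 * n),
        (if x 0 ≤ 2 * (n : ℤ) then
            criticalTwoPoint 3 x * criticalTwoPoint 3 (Pi.single 0 (n : ℤ))
         else 4 * ((((4 * n : ℕ) : ℤ) - x 0 : ℤ) : ℝ) / n * criticalTwoPoint 3 (Pi.single 0 (n : ℤ)) *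
           criticalTwoPoint 3 (Pi.single 0 (((4 * n : ℕ) : ℤ) - x 0 - 1))))
    (h2 : ∀ (F : Site 3 → ℝ) (K b : ℝ), 0 < K → 0 ≤ b → b ≤ 3 / 4 → F 0 = 1 →
      (∀ x : Site 3, x ≠ 0 → F x ≤ K * ‖x‖ ^ (-(1 + b))) →
      ∀ n : ℕ, 1 ≤ n →
        (∑ x ∈ box 3 (4 * n), F x) +
            (n : ℝ) * ∑ k ∈ Finset.Icc 1 (2 * n), (k : ℝ) * F (Pi.single 0 (k : ℤ)) ≤
          (1 + 872 * K) * (n : ℝ) ^ (2 - b)) :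
    WindowOfGrowth := by
  intro hA hE
  obtain ⟨κ', c₀, hκ', hc₀, N₀, hgrow⟩ := hA
  obtain ⟨η, hη⟩ := hE
  -- the tree's summed majorant bound (DC–Panis, proof of Thm 1.3), at `d = 3`, axis `e₁`
  have hsum : ∀ n : ℕ, 1 ≤ n → (∑ x ∈ box 3 (4 * n),
        (if x 0 ≤ 2 * (n : ℤ) then
            criticalTwoPoint 3 x * criticalTwoPoint 3 (Pi.single 0 (n : ℤ))
         else 4 * ((((4 * n : ℕ) : ℤ) - x 0 : ℤ) : ℝ) / n * criticalTwoPoint 3 (Pi.single 0 (n : ℤ)) *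
           criticalTwoPoint 3 (Pi.single 0 (((4 * n : ℕ) : ℤ) - x 0 - 1)))) ≤
      criticalTwoPoint 3 (Pi.single 0 (n : ℤ)) * (∑ x ∈ box 3 (4 * n), criticalTwoPoint 3 x) +
        4 * criticalTwoPoint 3 (Pi.single 0 (n : ℤ)) / n * ((2 * (4 * n : ℕ) + 1 : ℕ) : ℝ) ^ 2 *
          (1 + 2 * ∑ k ∈ Finset.Icc 1 (2 * n), (k : ℝ) * criticalTwoPoint 3 (Pi.single 0 (k : ℤ))) :=
    fun n hn => DCP.sum_majorant_le (d' := 2) (0 : Fin 3) hn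
  -- it suffices to show `η < 1/2` (the tree turns two-sided bounds with `η < 1/2` into WINDOW)
  refine Summit.CriticalPhenomena.Ising3DConformalLimit.Theorems.windowBelowHalf_of_hasIsingEtaBounds
    ?_ hη
  -- unpack the two-sided bounds
  have hη' := hη
  unfold HasIsingEtaBounds IsPowerBounded at hη'
  obtain ⟨c, C, hc, hbd⟩ := hη'
  have he : (-(((3 : ℕ) : ℝ) - 2 + η)) = -(1 + η) := by norm_num
  have hlow : ∀ x : Site 3, x ≠ 0 → c * ‖x‖ ^ (-(1 + η)) ≤ criticalTwoPoint 3 x := fun x hx => by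
    have h := (hbd x hx).1; rwa [he] at h
  have hupp : ∀ x : Site 3, x ≠ 0 → criticalTwoPoint 3 x ≤ C * ‖x‖ ^ (-(1 + η)) := fun x hx => by
    have h := (hbd x hx).2; rwa [he] at h
  -- basic facts on `G = criticalTwoPoint 3`
  have hG0 : ∀ x : Site 3, 0 ≤ criticalTwoPoint 3 x := fun x => DCP.critS_nonneg (d' := 2) x
  have hG00 : criticalTwoPoint 3 0 = 1 := twoPointPlus_origin (d := 3) _
  have hne : ∀ k : ℕ, 1 ≤ k → (Pi.single (0 : Fin 3) (k : ℤ) : Site 3) ≠ 0 := by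
    intro k hk h
    have h0 := congr_fun h 0
    simp at h0
    omega
  have hnorm : ∀ k : ℕ, ‖(Pi.single (0 : Fin 3) (k : ℤ) : Site 3)‖ = k := fun k => by
    rw [Pi.norm_single, Int.norm_natCast]
  -- `C > 0` (at `x = e₁`: `c ≤ G(e₁) ≤ C`)
  have hCpos : 0 < C := by
    have h1' := hlow _ (hne 1 le_rfl)
    have h2' := hupp _ (hne 1 le_rfl)
    rw [hnorm 1] at h1' h2'
    norm_num at h1' h2'
    linarith
  -- `η ≥ 0` from the infrared bound `G ≤ C' ‖x‖⁻¹`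
  obtain ⟨c', C', hc', hbnd'⟩ := criticalTwoPoint_bounds_holds (d := 3) (by norm_num)
  have hη0 : 0 ≤ η := by
    have key : ∀ k : ℕ, 1 ≤ k → c * (k : ℝ) ^ (-η) ≤ C' := by
      intro k hk
      have hkpos : (0 : ℝ) < k := by exact_mod_cast hk
      have hl := hlow _ (hne k hk)
      have hu := (hbnd' _ (hne k hk)).2
      rw [hnorm k] at hl hu
      rw [show -(((3 : ℕ) : ℝ) - 2) = -(1 : ℝ) by norm_num] at hu
      have hchain : c * (k : ℝ) ^ (-(1 + η)) ≤ C' * (k : ℝ) ^ (-(1 : ℝ)) := hl.trans hu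
      have hmul := mul_le_mul_of_nonneg_right hchain (Real.rpow_nonneg hkpos.le (1 : ℝ))
      have e1 : c * (k : ℝ) ^ (-(1 + η)) * (k : ℝ) ^ (1 : ℝ) = c * (k : ℝ) ^ (-η) := by
        rw [mul_assoc, ← Real.rpow_add hkpos]; congr 1; ring_nf
      have e2 : C' * (k : ℝ) ^ (-(1 : ℝ)) * (k : ℝ) ^ (1 : ℝ) = C' := by
        rw [mul_assoc, ← Real.rpow_add hkpos, show -(1 : ℝ) + 1 = 0 by ring, Real.rpow_zero, mul_one]
      rw [e1, e2] at hmul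
      exact hmul
    have := exponent_nonpos_of_bounded (N := 1) hc key
    linarith
  -- the auxiliary exponent `b = min η 3/4 ∈ [0, 3/4]`, `b ≤ η`
  set b : ℝ := min η (3 / 4) with hb_def
  have hb0 : 0 ≤ b := le_min hη0 (by norm_num)
  have hb34 : b ≤ 3 / 4 := min_le_right _ _
  have hbη : b ≤ η := min_le_left _ _
  -- the upper bound with exponent `1 + b`
  have hup : ∀ x : Site 3, x ≠ 0 → criticalTwoPoint 3 x ≤ C * ‖x‖ ^ (-(1 + b)) := by
    intro x hx
    have hx1 : (1 : ℝ) ≤ ‖x‖ := by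
      have h := norm_pos_iff.2 hx
      rw [Site.norm_eq_supNorm] at h ⊢
      exact_mod_cast Nat.one_le_iff_ne_zero.2 (by exact_mod_cast h.ne')
    refine (hupp x hx).trans (mul_le_mul_of_nonneg_left ?_ hCpos.le)
    exact Real.rpow_le_rpow_of_exponent_le hx1 (by linarith)
  -- the denominator bound (stub 2) for `F = G`, `K = C`
  have hden := h2 (criticalTwoPoint 3) C b hCpos hb0 hb34 hG00 hup
  -- abbreviation for the constant
  have hD1 : (1 : ℝ) ≤ 1 + 872 * C := by linarith
  have hD0 : (0 : ℝ) ≤ 1 + 872 * C := by linarith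
  -- MAIN ESTIMATE: for `n ≥ max N₀ 1`, `c₀ n^{κ'} ≤ 5838 C (1+872C) n^{1-2b}`
  have key : ∀ n : ℕ, max N₀ 1 ≤ n →
      c₀ * (n : ℝ) ^ (κ' - (1 - 2 * b)) ≤ 5838 * C * (1 + 872 * C) := by
    intro n hn
    have hnN : N₀ ≤ n := le_of_max_le_left hn
    have hn1 : 1 ≤ n := le_of_max_le_right hn
    have ht : (0 : ℝ) < n := by exact_mod_cast hn1
    have ht1 : (1 : ℝ) ≤ n := by exact_mod_cast hn1
    -- growth at scale `4n`, then stub 1, then the summed majorant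
    have hQ := (hgrow (4 * n) (by omega)).trans (h1 n hn1)
    have hS := hsum n hn1
    have hDen := hden n hn1
    -- the pieces
    have hGn0 : 0 ≤ criticalTwoPoint 3 (Pi.single 0 (n : ℤ)) := hG0 _
    have hGn : criticalTwoPoint 3 (Pi.single 0 (n : ℤ)) ≤ C * (n : ℝ) ^ (-(1 + b)) := by
      have := hup _ (hne n hn1)
      rwa [hnorm n] at this
    have hχ0 : 0 ≤ ∑ x ∈ box 3 (4 * n), criticalTwoPoint 3 x := sum_nonneg fun x _ => hG0 x
    have hK0 : 0 ≤ ∑ k ∈ Finset.Icc 1 (2 * n), (k : ℝ) * criticalTwoPoint 3 (Pi.single 0 (k : ℤ)) :=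
      sum_nonneg fun k _ => mul_nonneg (Nat.cast_nonneg k) (hG0 _)
    have hU0 : 0 ≤ (n : ℝ) ^ (2 - b) := Real.rpow_nonneg ht.le _
    have hA0 : 0 ≤ (n : ℝ) ^ (-(1 + b)) := Real.rpow_nonneg ht.le _
    have hχ : ∑ x ∈ box 3 (4 * n), criticalTwoPoint 3 x ≤ (1 + 872 * C) * (n : ℝ) ^ (2 - b) := by
      have : 0 ≤ (n : ℝ) * ∑ k ∈ Finset.Icc 1 (2 * n), (k : ℝ) * criticalTwoPoint 3 (Pi.single 0 (k : ℤ)) :=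
        mul_nonneg ht.le hK0
      linarith
    -- `t ≤ t^{2-b}` hence `1 ≤ (1+872C) t^{2-b} / t`
    have htU : (n : ℝ) ≤ (n : ℝ) ^ (2 - b) := by
      have := Real.rpow_le_rpow_of_exponent_le ht1 (show (1 : ℝ) ≤ 2 - b by linarith)
      rwa [Real.rpow_one] at this
    have hK : 1 + 2 * ∑ k ∈ Finset.Icc 1 (2 * n), (k : ℝ) * criticalTwoPoint 3 (Pi.single 0 (k : ℤ)) ≤
        3 * (1 + 872 * C) * (n : ℝ) ^ (2 - b) / n := by
      rw [le_div_iff₀ ht]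
      have hKn : (n : ℝ) * ∑ k ∈ Finset.Icc 1 (2 * n), (k : ℝ) * criticalTwoPoint 3 (Pi.single 0 (k : ℤ)) ≤
          (1 + 872 * C) * (n : ℝ) ^ (2 - b) := by linarith
      have h1n : (n : ℝ) ≤ (1 + 872 * C) * (n : ℝ) ^ (2 - b) := by nlinarith
      nlinarith
    have hP0 : 0 ≤ ((2 * (4 * n : ℕ) + 1 : ℕ) : ℝ) ^ 2 := by positivity
    have hP : ((2 * (4 * n : ℕ) + 1 : ℕ) : ℝ) ^ 2 ≤ 81 * (n : ℝ) ^ 2 := by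
      push_cast
      nlinarith
    have hmaj := majorant_algebra ht hA0 hU0 hCpos.le hD0 hGn0 hGn hχ0 hχ hK0 hK hP0 hP
    -- `A U = t^{1-2b}`
    have hAU : (n : ℝ) ^ (-(1 + b)) * (n : ℝ) ^ (2 - b) = (n : ℝ) ^ (1 - 2 * b) := by
      rw [← Real.rpow_add ht]; congr 1; ring
    rw [hAU] at hmaj
    -- chain: `c₀ (4n)^{κ'} ≤ 6 Σ maj ≤ 6 (…) ≤ 6 · 973 · C D t^{1-2b}`
    have hchain : c₀ * ((4 * n : ℕ) : ℝ) ^ κ' ≤ 6 * (973 * (C * (1 + 872 * C) * (n : ℝ) ^ (1 - 2 * b))) :=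
      hQ.trans ((mul_le_mul_of_nonneg_left hS (by norm_num)).trans
        (mul_le_mul_of_nonneg_left hmaj (by norm_num)))
    -- `n^{κ'} ≤ (4n)^{κ'}`
    have h4n : c₀ * (n : ℝ) ^ κ' ≤ c₀ * ((4 * n : ℕ) : ℝ) ^ κ' := by
      refine mul_le_mul_of_nonneg_left ?_ hc₀.le
      exact Real.rpow_le_rpow ht.le (by push_cast; linarith) hκ'.le
    -- divide by `n^{1-2b}`
    have hpow0 : 0 < (n : ℝ) ^ (1 - 2 * b) := Real.rpow_pos_of_pos ht _
    have hsplit : (n : ℝ) ^ (κ' - (1 - 2 * b)) = (n : ℝ) ^ κ' / (n : ℝ) ^ (1 - 2 * b) := by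
      rw [Real.rpow_sub ht]
    rw [hsplit, mul_div_assoc', div_le_iff₀ hpow0]
    calc c₀ * (n : ℝ) ^ κ' ≤ 6 * (973 * (C * (1 + 872 * C) * (n : ℝ) ^ (1 - 2 * b))) := h4n.trans hchain
      _ = 5838 * C * (1 + 872 * C) * (n : ℝ) ^ (1 - 2 * b) := by ring
  -- hence `κ' ≤ 1 - 2b`, i.e. `b ≤ (1 - κ')/2 < 1/2`, so `b = η` and `η < 1/2`
  have hexp := exponent_nonpos_of_bounded hc₀ key
  have hb12 : b < 1 / 2 := by linarith
  by_cases hη34 : η ≤ 3 / 4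
  · have : b = η := min_eq_left hη34
    linarith
  · exfalso
    have : b = 3 / 4 := min_eq_right (by linarith)
    linarith

/-- The line's end product: the crux BY NAME from the two stubs (carries `sorryAx` only through
`stub_reflGrad_le_majorant` and `stub_denominator_le`; becomes a closing proof once both land). -/
theorem WindowOfGrowth_proof : WindowOfGrowth :=
  WindowOfGrowth_of stub_reflGrad_le_majorant stub_denominator_le

end Summit.CriticalPhenomena.Ising3DConformalLimit.Cruxes.WindowOfGrowth.EtaDeficit
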